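import Summits.HubbardSuperconductivity.HubbardSuperconductivity.Theorems.LiebTwinNoOnsiteODLROKineticPairWindow
import Summits.HubbardSuperconductivity.HubbardSuperconductivity.Theorems.EnslavedA1gTorusNormalForms

/-!
# Crux `NoOnsiteODLRO` (stmt-HubbardSuperconductivity-0933), large-`U` shadow, part 3/3:
# a strict pair window at `U > 144/√δ` and the `O(U⁻²)` on-site condensate bound

For the repulsive Hubbard model on `(ℤ/Lℤ)²` at `t = 1`, hole density `≥ δ` (`2m+1+δL² ≤ L²`,
`N = 2m+2`): the window `κ_L = U - (E(N,0) - E(N-2,0))` satisfies **`κ_L ≥ U - 144/√δ`** for every `L`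
(`pairWindow_ge_largeU`; together with Yang's `κ_L ≥ 0` this makes the window STRICT and `L`-uniform
once `U > 144/√δ`, so the `U`-shifted pair-removal operator `K₋ = H - E_N + U` has no kernel there), and
every normalised sector ground state obeys the **on-site condensate bound**
`Re⟨ψ, P_sᴴP_s ψ⟩ ≤ 4c₁² L⁴/(U - 144/√δ)²` (`onsiteCondensate_le_largeU`, `c₁² = 32`), from the landed
lower sandwich `κ² S ≤ 4‖P_{s'}ψ‖²` (`enslavedA1gLowerSandwich_proof`). This is the provable large-`U`
shadow of the crux `NoOnsiteODLRO` (which asks `o(L⁴)` at EVERY fixed `U > 0`): the zero-temperature,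
doped analogue of Kubo–Kishi's `χ_pair ≤ 1/U` (PRB 41 (1990) 4866, Thm 2 — half filling only) in the
weak form "on-site condensate density `≤ C/U²`", with an explicit, `L`-uniform constant. It improves the
trivial `S_L ≤ 2L²⟨D⟩ = O(L⁴/U)` in its `U`-dependence and closes the `η`-saturation loophole of the
line's open infrared-bound stub at large `U`. All folklore bookkeeping on landed tree results.
-/

noncomputable section

namespace Summit.HubbardSuperconductivity.NoOnsiteODLRO.LargeU

open Matrix Finset
open Literature.Probability.LatticeModels Literature.MathematicalPhysics.QuantumLattice
open scoped ComplexOrder Matrix.Norms.L2Operator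

/-! ### The large-`U` strict window and the `O(U⁻²)` on-site condensate bound (`t = 1`) -/

section Condensate

variable (L : ℕ) [NeZero L]

/-- **Strict pair chemical-potential window at large `U` (lower half, `L`-uniform).** At hole density
`≥ δ` — precisely `N + 1 ≤ (1 - δ) L² + 1`, i.e. `L² - N + 1 ≥ δ L²` with `N = 2m + 2` — the window
`κ = U - (E(N,0) - E(N-2,0))` of `hubbardTorus 2 L 1 U` satisfies `κ ≥ U - 144/√δ`; in particular it is
bounded away from `0`, uniformly in `L`, as soon as `U > 144/√δ` (then `ker(H - E_N + U) = 0` on the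
pair-removed sector: no `η`-saturation of Yang's window). [folklore] -/
theorem pairWindow_ge_largeU (U : ℝ) {δ : ℝ} (hδ : 0 < δ) {m : ℕ}
    (hm : (2 * (m : ℝ) + 1) + δ * (L : ℝ) ^ 2 ≤ (L : ℝ) ^ 2) :
    U - 144 / Real.sqrt δ ≤
      U - ((hubbardTorus 2 L 1 U).minEnergyOn (szSector (2 * m + 2) 0) -
        (hubbardTorus 2 L 1 U).minEnergyOn (szSector (2 * m) 0)) := by
  have hLpos : (0 : ℝ) < (L : ℝ) := by exact_mod_cast Nat.pos_of_ne_zero (NeZero.ne L)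
  have hL2pos : (0 : ℝ) < (L : ℝ) ^ 2 := by positivity
  have hmL : 2 * m + 2 ≤ L ^ 2 := by
    have h1 : (2 * (m : ℝ) + 1) < (L : ℝ) ^ 2 := by nlinarith
    have h2 : ((2 * m + 1 : ℕ) : ℝ) < ((L ^ 2 : ℕ) : ℝ) := by push_cast; exact h1
    have h3 : 2 * m + 1 < L ^ 2 := by exact_mod_cast h2
    omega
  have h := minEnergyOn_szSector_add_two_le_kinetic L 1 U hmL
  rw [abs_one, mul_one] at h
  -- `(L²/(L² - 2m - 1))^{1/2} ≤ 1/√δ`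
  have hden : 0 < (L : ℝ) ^ 2 - (2 * m + 1) := by nlinarith
  have hfrac : (L : ℝ) ^ 2 / ((L : ℝ) ^ 2 - (2 * m + 1)) ≤ 1 / δ := by
    rw [div_le_div_iff₀ hden hδ]
    nlinarith
  have hsq : Real.sqrt ((L : ℝ) ^ 2 / ((L : ℝ) ^ 2 - (2 * m + 1))) ≤ 1 / Real.sqrt δ := by
    rw [← Real.sqrt_one, ← Real.sqrt_div zero_le_one, Real.sqrt_one]
    exact Real.sqrt_le_sqrt hfrac
  have h144 : 144 * Real.sqrt ((L : ℝ) ^ 2 / ((L : ℝ) ^ 2 - (2 * m + 1))) ≤ 144 / Real.sqrt δ := by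
    have e : 144 / Real.sqrt δ = 144 * (1 / Real.sqrt δ) := by ring
    rw [e]
    exact mul_le_mul_of_nonneg_left hsq (by norm_num)
  linarith

/-- **The `O(U⁻²)` on-site condensate bound at large `U`.** For `U > 144/√δ`, even `L ≥ 3`, and a
normalised ground state `ψ` of `hubbardTorus 2 L 1 U` in the sector `(N, S^z=0)`, `N = 2m + 2`, at hole
density `≥ δ` (`2m + 1 + δL² ≤ L²`):
`Re⟨ψ, P_sᴴ P_s ψ⟩ ≤ 4 c₁² L⁴ / (U - 144/√δ)²`, `c₁ = 2 Σ_{e ∈ {0} ∪ unitSteps} |s'(e)/√2|` (`c₁² = 32`),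
`P_s = pairField sWave L`: the on-site pair condensate density is `O(U⁻²)`, uniformly in `L`. Proof: the
landed lower sandwich `κ² S ≤ 4 ‖P_{s'}ψ‖² ≤ 4 c₁² L⁴` (`enslavedA1gLowerSandwich_proof`, Shastry/Zhang) and
the strict window `κ ≥ U - 144/√δ > 0` (`pairWindow_ge_largeU`). This is the zero-temperature, doped
shadow of Kubo–Kishi's `χ_pair ≤ 1/U` (PRB 41 (1990) 4866, Thm 2, half filling only), in the weak form
"condensate density `≤ C/U²`"; it does not give `o(L⁴)` at fixed `U` (the crux `NoOnsiteODLRO`). [folklore] -/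
theorem onsiteCondensate_le_largeU {U δ : ℝ} (hδ : 0 < δ) (hU : 144 / Real.sqrt δ < U) (hLe : Even L)
    (hL : 2 < L) {m : ℕ} (hm : (2 * (m : ℝ) + 1) + δ * (L : ℝ) ^ 2 ≤ (L : ℝ) ^ 2)
    {ψ : Fock (Orb (FermionTorus 2 L))} (hψ1 : star ψ ⬝ᵥ ψ = 1)
    (hGS : IsGroundStateInSector (hubbardTorus 2 L 1 U) (2 * m + 2) 0 ψ) :
    (expect ((pairField sWave L)ᴴ * pairField sWave L) ψ).re ≤
      4 * (2 * ∑ e ∈ insert (0 : Site 2) unitSteps, |extendedSWave e / Real.sqrt 2|) ^ 2 * (L : ℝ) ^ 4 /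
        (U - 144 / Real.sqrt δ) ^ 2 := by
  have hLpos : (0 : ℝ) < (L : ℝ) := by exact_mod_cast Nat.pos_of_ne_zero (NeZero.ne L)
  have hδL : 0 < δ * (L : ℝ) ^ 2 := by positivity
  have hmL : 2 * m + 2 ≤ L ^ 2 := by
    have h1 : (2 * (m : ℝ) + 1) < (L : ℝ) ^ 2 := by linarith
    have h2 : ((2 * m + 1 : ℕ) : ℝ) < ((L ^ 2 : ℕ) : ℝ) := by push_cast; exact h1
    have h3 : 2 * m + 1 < L ^ 2 := by exact_mod_cast h2
    omega
  have hUpos : 0 < U := lt_of_le_of_lt (by positivity) hU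
  set κ₀ : ℝ := U - 144 / Real.sqrt δ with hκ₀
  have hκ₀pos : 0 < κ₀ := by rw [hκ₀]; linarith
  -- the lower sandwich (iii): `κ² S ≤ 4 S'`
  obtain ⟨hκ, -, hiii⟩ := Summit.HubbardSuperconductivity.EnslavedA1g.enslavedA1gLowerSandwich_proof U hUpos.le L
    hLe hL (2 * m + 2) ψ (by omega) hmL hψ1 hGS
  have h2m : 2 * m + 2 - 2 = 2 * m := by omega
  rw [h2m] at hκ hiii
  set κ : ℝ := U - ((hubbardTorus 2 L 1 U).minEnergyOn (szSector (2 * m + 2) 0) -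
    (hubbardTorus 2 L 1 U).minEnergyOn (szSector (2 * m) 0)) with hκdef
  set S : ℝ := (expect ((pairField sWave L)ᴴ * pairField sWave L) ψ).re with hS
  set S' : ℝ := (expect ((pairField extendedSWave L)ᴴ * pairField extendedSWave L) ψ).re with hS'
  set c₁ : ℝ := 2 * ∑ e ∈ insert (0 : Site 2) unitSteps, |extendedSWave e / Real.sqrt 2| with hc₁
  -- the window: `κ ≥ κ₀ > 0`
  have hκge : κ₀ ≤ κ := pairWindow_ge_largeU L U hδ hm
  -- a priori: `S' ≤ c₁² L⁴`
  have hS'le : S' ≤ (c₁ * (L : ℝ) ^ 2) ^ 2 := by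
    rw [hS', PosSemidefTrace.expect_conjTranspose_mul, ← eucNorm_sq]
    have h1 : eucNorm (pairField extendedSWave L *ᵥ ψ) ≤ c₁ * (L : ℝ) ^ 2 := by
      refine (eucNorm_mulVec_le _ _).trans ?_
      rw [eucNorm_eq_one hψ1, mul_one]
      exact norm_pairField_le extendedSWave L
    exact pow_le_pow_left₀ (eucNorm_nonneg _) h1 2
  have hSnn : 0 ≤ S := by
    rw [hS, PosSemidefTrace.expect_conjTranspose_mul]
    exact Summit.HubbardSuperconductivity.HubbardSuperconductivity.Theorems.EnslavedA1g.UpperSandwich.re_star_dotProduct_self_nonneg _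
  -- `κ₀² S ≤ κ² S ≤ 4 S' ≤ 4 c₁² L⁴`
  have h1 : κ₀ ^ 2 * S ≤ κ ^ 2 * S :=
    mul_le_mul_of_nonneg_right (pow_le_pow_left₀ hκ₀pos.le hκge 2) hSnn
  have h2 : κ₀ ^ 2 * S ≤ 4 * (c₁ * (L : ℝ) ^ 2) ^ 2 := by linarith [hiii]
  rw [le_div_iff₀ (pow_pos hκ₀pos 2)]
  calc S * κ₀ ^ 2 = κ₀ ^ 2 * S := by ring
    _ ≤ 4 * (c₁ * (L : ℝ) ^ 2) ^ 2 := h2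
    _ = 4 * c₁ ^ 2 * (L : ℝ) ^ 4 := by ring

/-- The crude a-priori constant of the extended-`s` pair field, evaluated: `(2 Σ_{e ∈ {0} ∪ unitSteps} |s'(e)/√2|)² = 32`
(`s'(0) = 0`, `s' = 1` on the four unit steps). [folklore] -/
theorem extendedSWave_aprioriConst_sq :
    (2 * ∑ e ∈ insert (0 : Site 2) unitSteps, |extendedSWave e / Real.sqrt 2|) ^ 2 = 32 := by
  rw [Finset.sum_insert Summit.HubbardSuperconductivity.EnslavedA1g.zero_notMem_unitSteps,
    Summit.HubbardSuperconductivity.EnslavedA1g.extendedSWave_zero, zero_div, abs_zero, zero_add]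
  have h : ∑ e ∈ unitSteps, |extendedSWave e / Real.sqrt 2| = ∑ _e ∈ unitSteps, (1 / Real.sqrt 2 : ℝ) :=
    Finset.sum_congr rfl fun e he => by
      rw [Summit.HubbardSuperconductivity.EnslavedA1g.extendedSWave_of_mem_unitSteps he, abs_of_pos (by positivity)]
  rw [h, Finset.sum_const, Summit.HubbardSuperconductivity.EnslavedA1g.card_unitSteps, nsmul_eq_mul]
  have h2 : Real.sqrt 2 ^ 2 = 2 := Real.sq_sqrt (by norm_num)
  rw [show (2 : ℝ) * ((4 : ℕ) * (1 / Real.sqrt 2)) = 8 / Real.sqrt 2 by push_cast; ring, div_pow, h2]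
  norm_num

/-- **The `O(U⁻²)` on-site condensate bound along admissible sequences** (the crux's own format). For
`δ ∈ (0, 1/2)`, `U > 144/√δ` and every admissible `(N_L, S^z = 0)`-sector ground-state family `ψ_L` of
`hubbardTorus 2 L 1 U` (`N_L = 2⌊(1-δ)L²/2⌋`, normalised), for EVERY even `L ≥ 3`:
`Re⟨ψ_L, P_sᴴ P_s ψ_L⟩ ≤ 128 L⁴/(U - 144/√δ)²`. Compare the crux `NoOnsiteODLRO`: `… / L⁴ → 0` for every
fixed `U > 0` — here only `limsup ≤ 128/(U - 144/√δ)² = O(U⁻²)`, but unconditional, explicit and uniform in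
`L` and in the ground state. [folklore] -/
theorem onsiteCondensate_le_largeU_admissible :
    ∀ (U δ : ℝ), δ ∈ Set.Ioo (0 : ℝ) (1 / 2) → 144 / Real.sqrt δ < U →
      ∀ (N : ℕ → ℕ) (ψ : ∀ L, Fock (Orb (FermionTorus 2 L))),
        (∀ L, Even L → N L = 2 * ⌊(1 - δ) * (L : ℝ) ^ 2 / 2⌋₊ ∧ star (ψ L) ⬝ᵥ ψ L = 1 ∧
            IsGroundStateInSector (hubbardTorus 2 L 1 U) (N L) 0 (ψ L)) →
          ∀ (L : ℕ) [NeZero L], Even L → 3 ≤ L →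
            (expect ((pairField sWave L)ᴴ * pairField sWave L) (ψ L)).re ≤
              128 * (L : ℝ) ^ 4 / (U - 144 / Real.sqrt δ) ^ 2 := by
  intro U δ hδ hU N ψ hyp L _ hE hL
  obtain ⟨hN, hψ1, hGS⟩ := hyp L hE
  set k : ℕ := ⌊(1 - δ) * (L : ℝ) ^ 2 / 2⌋₊ with hk
  have hL3 : (3 : ℝ) ≤ L := by exact_mod_cast hL
  have hL9 : (9 : ℝ) ≤ (L : ℝ) ^ 2 := by nlinarith [hL3]
  have hk1 : 1 ≤ k := by
    refine Nat.le_floor ?_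
    rw [Nat.cast_one, le_div_iff₀ (by norm_num : (0 : ℝ) < 2)]
    nlinarith [hδ.2]
  -- `N L = 2 (k - 1) + 2` and the density condition `2(k-1) + 1 + δ L² ≤ L²`
  have hNm : N L = 2 * (k - 1) + 2 := by rw [hN]; omega
  have hfl : (k : ℝ) ≤ (1 - δ) * (L : ℝ) ^ 2 / 2 := Nat.floor_le (by nlinarith [hδ.2])
  have hkR : ((k - 1 : ℕ) : ℝ) = (k : ℝ) - 1 := by
    rw [Nat.cast_sub hk1, Nat.cast_one]
  have hm : (2 * ((k - 1 : ℕ) : ℝ) + 1) + δ * (L : ℝ) ^ 2 ≤ (L : ℝ) ^ 2 := by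
    rw [hkR]; nlinarith
  rw [hNm] at hGS
  have hL2 : 2 < L := by omega
  have h := onsiteCondensate_le_largeU L hδ.1 hU hE hL2 hm hψ1 hGS
  rwa [extendedSWave_aprioriConst_sq, show (4 : ℝ) * 32 * (L : ℝ) ^ 4 = 128 * (L : ℝ) ^ 4 by ring] at h

end Condensate

/-- REGISTERED SUB-GOAL `stub_largeUCondensateBound` (crux stmt-HubbardSuperconductivity-0933): the
`O(U⁻²)` on-site condensate bound at `U > 144/√δ` (`onsiteCondensate_le_largeU`). [folklore] -/
theorem stub_largeUCondensateBound : ∀ (L : ℕ) [NeZero L] (U δ : ℝ), 0 < δ → 144 / Real.sqrt δ < U → Even L → 2 < L → ∀ (m : ℕ), (2 * (m : ℝ) + 1) + δ * (L : ℝ) ^ 2 ≤ (L : ℝ) ^ 2 → ∀ (ψ : Fock (Orb (FermionTorus 2 L))), star ψ ⬝ᵥ ψ = 1 → IsGroundStateInSector (hubbardTorus 2 L 1 U) (2 * m + 2) 0 ψ → (expect ((pairField sWave L)ᴴ * pairField sWave L) ψ).re ≤ 4 * (2 * ∑ e ∈ insert (0 : Site 2) unitSteps, |extendedSWave e / Real.sqrt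 2|) ^ 2 * (L : ℝ) ^ 4 / (U - 144 / Real.sqrt δ) ^ 2 :=
  fun L _ _ _ hδ hU hLe hL _ hm _ hψ1 hGS => onsiteCondensate_le_largeU L hδ hU hLe hL hm hψ1 hGS

end Summit.HubbardSuperconductivity.NoOnsiteODLRO.LargeU

end
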